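import Literature.NumberTheory.GaloisCohomology.CyclicClassLocalNorm
import Literature.NumberTheory.NumberFields.ArtinMapLocalNormKernel
import Literature.NumberTheory.GaloisRepresentations.GlobalExistenceTheoremReductionProofs
import Literature.NumberTheory.GaloisRepresentations.NormResidueSymbolIdentityComponent
import HarnessLib

/-!
# The sum of the local invariants of a global cyclic class vanishes
# (Tate, Cassels–Fröhlich VII §10; Serre XIV §1; Neukirch VI (5.6)–(5.8))

Let `K` be a number field, `n ≥ 1`, `ψ : Γ_K ↠ ℤ/n` a cyclic character cutting out the finite
abelian `L ⊆ K̄` (`ker ψ = Gal(K̄/L)`), `b ∈ Kˣ`, and `c = κₙ(b) ∪ ψ ∈ H²(Γ_K, μₙ)` the global cyclic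
class (cup product of the Kummer class of `b` with `σ ↦ (ψ σ)·id ∈ μₙ^∨(1)`; minus the class of the
cyclic algebra `(L/K, ψ, b)` in `Br(K)[n]`).  For a finite place `v` let
`inv_v = localInvariantMap K n v` be THE invariant map of `K_v` (`LocalInvariantMap.lean`).

**Theorem** (`sum_localInvariantMap_localization_cupProduct_δ₀_eq_zero`).  Suppose that
`loc_v c = 0` at every finite place `v` at which `ψ` is ramified (`ψ ∘ res_v` does not kill the
inertia group of `Γ_{K_v}`), and that the Artin map `ψ_{L|K}` kills the archimedean idèle
`(b)_∞` (automatic for `K` totally complex — `…_of_isTotallyComplex`).  Then for every finite set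
`S` of finite places with `inv_v (loc_v c) = 0` for `v ∉ S`,

  `∑_{v ∈ S} inv_v (loc_v c) = 0`.

This is the reciprocity step of Tate's proof of `∑_v inv_v = 0` on `Br(K)` (Cassels–Fröhlich VII
§10, for classes split by a cyclic extension), here obtained FROM the tree's Artin reciprocity
(`ker ψ_{L|K} ⊇ Kˣ`) and local–global compatibility (Neukirch VI (5.6), (5.8); tree
`ArtinMapLocalNormKernel.lean`):

* at a place where `ψ` is unramified, `inv_v (loc_v c) = ψ(Frob_v) · ord_v(b)`
  (`localInvariantMap_localization_cupProduct_δ₀`, Serre XIV §1 Prop. 3) and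
  `ψ_{L|K}(⟨b⟩_v) = ((res w)|_L)⁻¹` for `Art_v w = b` (`artinIdeleMap_localUnits_canonicalArtin_eq_inv`)
  with `ord_v(Art_v w) = -deg w` (Deligne's normalisation), so both sides read `-ψ(res w)`;
* at a ramified place, `loc_v c = 0` forces `b ∈ N((K_vL)ˣ)`
  (`mem_range_norm_compositum_of_resMu_cupProduct_δ₀_eq_zero`), hence `ψ_{L|K}(⟨b⟩_v) = 1`
  (`artinIdeleMap_localUnits_eq_one_iff_mem_range_norm`);
* globally, the principal idèle of `b` is `∏_{v ∈ S'} ⟨b⟩_v · (b)_∞ · u` with `u ∈ U_K^{S'}` in the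
  (open) norm group for `S'` large (`exists_map_unitIdelesOutside_le`), and `ψ_{L|K}(b) = 1`
  (`artinIdeleMap_eq_one_of_mem_principalIdeles`), so `∏_v ψ_{L|K}(⟨b⟩_v) = 1`; applying the
  character `ψ̄` of `G(L|K)` induced by `ψ` gives the sum.

Proof file: theorems only, no named fact, no instance (D-0026).  Input of the tree's discharge of
`poitouTate_sum_localTatePairing_eq_zero` (Albert–Brauer–Hasse–Noether for THE invariant maps).

## References

* J. Tate, *Global class field theory*, Ch. VII of Cassels–Fröhlich (eds.), *Algebraic Number
  Theory* (1967), §9.6, §10, §11.2. [CasselsFrohlichANT1967]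
* J.-P. Serre, *Corps locaux* / *Local Fields* (1979), XIV §1 Prop. 2–3. [SerreLocalFields1979]
* J. Neukirch, *Algebraic Number Theory* (1999), VI (5.6)–(5.8). [NeukirchANT1999]

## Tree search

`lean search 'sum_localInvariantMap|BrauerSumInv'`: no prior declaration.  Inputs: T-loc
(`LocalInvariantMapEvaluation`), T-norm (`CyclicClassLocalNorm`), `ArtinMapLocalNormKernel`
(`artinIdeleMap_localUnits_canonicalArtin_eq_inv`, `artinIdeleMap_localUnits_eq_one_iff_mem_range_norm`),
`ker_artinClassMap_eq`, `isOpen_normClassGroup'`, `exists_map_unitIdelesOutside_le`,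
`ArtinLocalGlobal.exists_deg_eq_one/exists_eq_zpow_mul_inertia`, `isLocalArtinMap_canonicalArtin_holds`,
idèle API (`principalIdele`, `localUnits`, `infiniteIdeles`, `snd_prod_localUnits`).
-/

noncomputable section

open CategoryTheory Function NumberField IsDedekindDomain Field ValuativeRel
open scoped NumberField

namespace Literature.NumberTheory.GaloisCohomology

open _root_.ContinuousCohomology
open Literature.NumberTheory.GaloisRepresentations
open Literature.NumberTheory.GaloisRepresentations.DiscreteGaloisModule
open Literature.NumberTheory.GaloisRepresentations.LocalWeilDatum
open Literature.NumberTheory.GaloisRepresentations.IsNonarchimedeanLocalField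
open Literature.NumberTheory.NumberFields
open Literature.AnabelianGeometry.AbsoluteAnabelian
open Literature.AnabelianGeometry.AbsoluteAnabelian.Prop121vii

variable {K : Type} [Field K] [NumberField K] {n : ℕ} [NeZero n]
  (L : IntermediateField K (AlgebraicClosure K)) [FiniteDimensional K L] [IsAbelianGalois K L]
  [NumberField L]

/-! ### §1. Local lemmas on the Weil group and the Artin map of `K_v` -/

section LocalArtin

variable (v : HeightOneSpectrum (𝓞 K))

/-- **`ord_v(Art_v w) = -deg w`** for THE local Artin map of `K_v` (Deligne's normalisation:
inertia onto units, geometric Frobenius — degree `-1` — onto uniformisers;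
`IsLocalArtinMap.image_inertia/artin_frob`). [cite: TateCorvallis1979, (1.4.1)] -/
theorem ord_canonicalArtin (w : WeilGroup (v.adicCompletion K)) :
    ord (v.adicCompletion K) (canonicalArtin (v.adicCompletion K) w : v.adicCompletion K) =
      -WeilGroup.deg w := by
  set F := v.adicCompletion K with hF
  have ha := isLocalArtinMap_canonicalArtin_holds F
  obtain ⟨u, hu⟩ := ArtinLocalGlobal.exists_deg_eq_one v
  obtain ⟨i, hi, hw⟩ := ArtinLocalGlobal.exists_eq_zpow_mul_inertia v hu w
  -- inertia goes to units
  have hiu : valuation F (canonicalArtin F i : F) = 1 := by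
    have hmem : canonicalArtin F i ∈ (valuation F).valuationSubring.unitGroup := by
      rw [← ha.image_inertia]; exact Subgroup.mem_map_of_mem _ hi
    exact (Valuation.mem_unitGroup_iff _ _ _).mp hmem
  have hordi : ord F (canonicalArtin F i : F) = 0 := (ord_eq_zero_iff F (Units.ne_zero _)).mpr hiu
  -- `u⁻¹` is a geometric Frobenius, `Art u⁻¹` a uniformiser
  have hdeg : WeilGroup.deg u⁻¹ = -1 := by
    rw [WeilGroup.deg_inv IsFrobPow.mul_holds IsFrobPow.unique_holds, hu]
  have hunif : (valuation F).IsUniformizer (canonicalArtin F u⁻¹ : F) := ha.artin_frob _ hdeg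
  have hordu' : ord F (canonicalArtin F u⁻¹ : F) = 1 := (ord_eq_one_iff F (Units.ne_zero _)).mpr hunif
  have hordu : ord F (canonicalArtin F u : F) = -1 := by
    have h := ord_mul F (Units.ne_zero (canonicalArtin F u)) (Units.ne_zero (canonicalArtin F u⁻¹))
    rw [← Units.val_mul, ← map_mul, mul_inv_cancel, map_one, Units.val_one, ord_one, hordu'] at h
    omega
  have hordzpow : ∀ m : ℤ, ord F ((canonicalArtin F u : F) ^ m) = -m := by
    intro m
    obtain ⟨k, rfl | rfl⟩ := Int.eq_nat_or_neg m
    · rw [zpow_natCast, ord_pow F (Units.ne_zero _), hordu]; ring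
    · have h1 : ord F ((canonicalArtin F u : F) ^ (k : ℤ)) = -k := by
        rw [zpow_natCast, ord_pow F (Units.ne_zero _), hordu]; ring
      have h2 := ord_mul F (zpow_ne_zero (-(k : ℤ)) (Units.ne_zero (canonicalArtin F u)))
        (zpow_ne_zero (k : ℤ) (Units.ne_zero (canonicalArtin F u)))
      rw [← zpow_add₀ (Units.ne_zero _), neg_add_cancel, zpow_zero, ord_one, h1] at h2
      omega
  have key : ord F (canonicalArtin F (u ^ WeilGroup.deg w * i) : F) = -WeilGroup.deg w := by
    rw [map_mul, map_zpow, Units.val_mul, Units.val_zpow_eq_zpow_val,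
      ord_mul F (zpow_ne_zero _ (Units.ne_zero _)) (Units.ne_zero _), hordzpow, hordi, add_zero]
  rwa [← hw] at key

omit [NeZero n] in
/-- **A character killing inertia, evaluated on the Weil group**: if `ψ ∘ res_v` kills the inertia
group of `Γ_{K_v}` and takes the value `f` on arithmetic Frobenius lifts, then
`ψ(res w) = deg w · f` for every `w ∈ W_{K_v}` (`W_{K_v}` is generated by inertia and a Frobenius).
[cite: SerreLocalFields1979, XIII §4 Prop. 13] -/
theorem apply_absGaloisRestrict_toAbsGalois_eq (ψ : CyclicCharacter (absoluteGaloisGroup K) n)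
    (hψI : ∀ σ ∈ absInertia (v.adicCompletion K), ψ (absGaloisRestrict K (v.adicCompletion K) σ) = 0)
    {f : ℕ} (hf : ∀ φ : absoluteGaloisGroup (v.adicCompletion K), IsFrobPow φ 1 →
      ψ (absGaloisRestrict K (v.adicCompletion K) φ) = (f : ZMod n))
    (w : WeilGroup (v.adicCompletion K)) :
    ψ (absGaloisRestrict K (v.adicCompletion K) (WeilGroup.toAbsGalois (v.adicCompletion K) w)) =
      (WeilGroup.deg w : ZMod n) * (f : ZMod n) := by
  set F := v.adicCompletion K with hF
  obtain ⟨u, hu⟩ := ArtinLocalGlobal.exists_deg_eq_one v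
  obtain ⟨i, hi, hw⟩ := ArtinLocalGlobal.exists_eq_zpow_mul_inertia v hu w
  have hu1 : IsFrobPow (WeilGroup.toAbsGalois F u) 1 :=
    (WeilGroup.deg_eq_iff IsFrobPow.mul_holds IsFrobPow.unique_holds).mp hu
  -- the character on the Weil group, as a monoid homomorphism
  let χ : WeilGroup F →* Multiplicative (ZMod n) :=
    ψ.toMonoidHom.comp ((absGaloisRestrict K F).toMonoidHom.comp (WeilGroup.toAbsGalois F))
  have hχ : ∀ x, χ x = Multiplicative.ofAdd (ψ (absGaloisRestrict K F (WeilGroup.toAbsGalois F x))) :=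
    fun _ => rfl
  have hχi : χ i = 1 := by
    rw [hχ, hψI _ (WeilGroup.mem_inertia_iff.mp hi), ofAdd_zero]
  have hχu : χ u = Multiplicative.ofAdd (f : ZMod n) := by rw [hχ, hf _ hu1]
  have key : χ (u ^ WeilGroup.deg w * i) = Multiplicative.ofAdd ((WeilGroup.deg w : ZMod n) * (f : ZMod n)) := by
    rw [map_mul, map_zpow, hχi, mul_one, hχu, ← ofAdd_zsmul, zsmul_eq_mul]
  rw [← hw] at key
  exact Multiplicative.ofAdd.injective ((hχ w).symm.trans key)

end LocalArtin

/-! ### §2. The principal idèle decomposed along a finite set of places -/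

section Idele

/-- **`b = ∏_{v ∈ S} ⟨b⟩_v · (b)_∞ · u` with `u ∈ U_K^S`** for every finite set `S` of finite places
containing those where `b` is not a unit (componentwise bookkeeping in `𝕀_K`).
[cite: Neukirch2013, Part III §7, p. 175] -/
theorem principalIdele_mem_mul_unitIdelesOutside (b : Kˣ) (S : Finset (HeightOneSpectrum (𝓞 K)))
    (hS : ∀ v ∉ S, Valued.v (algebraMap K (v.adicCompletion K) (b : K)) = 1) :
    ∃ u ∈ unitIdelesOutside K S, principalIdele K b =
      (∏ v ∈ S, localUnits v (globalToLocalUnits v b)) * infiniteIdeles K (globalToInfiniteUnits K b) * u := by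
  classical
  set w : ideleGroup K := (∏ v ∈ S, localUnits v (globalToLocalUnits v b)) *
    infiniteIdeles K (globalToInfiniteUnits K b) with hwdef
  refine ⟨w⁻¹ * principalIdele K b, ?_, by rw [← mul_assoc, mul_inv_cancel, one_mul]⟩
  have hw1 : (w : AdeleRing (𝓞 K) K).1 = (principalIdele K b : AdeleRing (𝓞 K) K).1 := by
    rw [hwdef, ideleGroup_val_fst_mul, fst_prod_localUnits, one_mul, infiniteIdeles_fst,
      val_globalToInfiniteUnits, principalIdele_fst]
  have hw2 : ∀ v, (w : AdeleRing (𝓞 K) K).2 v =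
      if v ∈ S then algebraMap K (v.adicCompletion K) (b : K) else 1 := by
    intro v
    rw [hwdef, ideleGroup_val_snd_mul, infiniteIdeles_snd, mul_one, snd_prod_localUnits]
    split_ifs <;> simp [val_globalToLocalUnits]
  refine ⟨?_, fun v hv => ?_, fun v => ?_⟩
  · -- infinite component
    have h : ((w⁻¹ * principalIdele K b : ideleGroup K) : AdeleRing (𝓞 K) K).1 =
        ((w⁻¹ * w : ideleGroup K) : AdeleRing (𝓞 K) K).1 := by
      rw [ideleGroup_val_fst_mul, ideleGroup_val_fst_mul, hw1]
    rw [h, inv_mul_cancel]; rfl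
  · -- components in `S`
    have h : ((w⁻¹ * principalIdele K b : ideleGroup K) : AdeleRing (𝓞 K) K).2 v =
        ((w⁻¹ * w : ideleGroup K) : AdeleRing (𝓞 K) K).2 v := by
      rw [ideleGroup_val_snd_mul, ideleGroup_val_snd_mul, hw2, if_pos hv, principalIdele_snd]
    rw [h, inv_mul_cancel]; rfl
  · -- all finite components are units
    by_cases hv : v ∈ S
    · have h : ((w⁻¹ * principalIdele K b : ideleGroup K) : AdeleRing (𝓞 K) K).2 v =
          ((w⁻¹ * w : ideleGroup K) : AdeleRing (𝓞 K) K).2 v := by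
        rw [ideleGroup_val_snd_mul, ideleGroup_val_snd_mul, hw2, if_pos hv, principalIdele_snd]
      rw [h, inv_mul_cancel]
      exact (unitIdeles K).one_mem v
    · rw [ideleGroup_val_snd_mul, ideleGroup_val_inv_snd, hw2, if_neg hv, inv_one, one_mul,
        principalIdele_snd]
      exact hS v hv

/-- The finite places at which `b ∈ Kˣ` is not a local unit form a finite set (the principal idèle
lies in the restricted product). [cite: CasselsFrohlichANT1967, Ch. II §14] -/
theorem finite_setOf_valued_ne_one (b : Kˣ) :
    Set.Finite {v : HeightOneSpectrum (𝓞 K) | Valued.v (algebraMap K (v.adicCompletion K) (b : K)) ≠ 1} := by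
  have hunit : IsUnit ((principalIdele K b : ideleGroup K) : AdeleRing (𝓞 K) K).2 :=
    (Units.map (MonoidHom.snd (InfiniteAdeleRing K) (FiniteAdeleRing (𝓞 K) K)) (principalIdele K b)).isUnit
  have h := (FiniteAdeleRing.isUnit_iff.mp hunit).2
  rw [Filter.eventually_cofinite] at h
  refine h.subset fun v hv => ?_
  simpa only [Set.mem_setOf_eq, principalIdele_snd] using hv

end Idele

/-! ### §3. The sum formula -/

section Sum

/-- **`∑_{v ∈ S} inv_v (loc_v (κₙ(b) ∪ ψ)) = 0`** (Tate, Cassels–Fröhlich VII §10; see the module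
docstring): for a cyclic character `ψ : Γ_K ↠ ℤ/n` with `ker ψ = Gal(K̄/L)`, `L ⊆ K̄` finite abelian,
`b ∈ Kˣ`, provided the class `κₙ(b) ∪ ψ` vanishes at the finite places where `ψ` is ramified, the
Artin map `ψ_{L|K}` kills the archimedean idèle of `b`, and `S` is a finite set of finite places off
which the local invariants of the class vanish. [cite: CasselsFrohlichANT1967, Ch. VII §10]
[cite: NeukirchANT1999, Ch. VI §5 Prop. (5.6), Cor. (5.8)] -/
theorem sum_localInvariantMap_localization_cupProduct_δ₀_eq_zero
    (ψ : CyclicCharacter (absoluteGaloisGroup K) n) (hker : ψ.ker = galFixing K L) (b : Kˣ)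
    (hinf : artinIdeleMap L artinReciprocity_character_holds
      (infiniteIdeles K (globalToInfiniteUnits K b)) = 1)
    (hram : ∀ v : HeightOneSpectrum (𝓞 K),
      (∃ σ ∈ absInertia (v.adicCompletion K), ψ (absGaloisRestrict K (v.adicCompletion K) σ) ≠ 0) →
      haveI : CompactSpace (absoluteGaloisGroup K) := absoluteGaloisGroup_compactSpace K
      galoisCohomology.localization (mu K n) (Sum.inr v) 2 (((mu K n).tateDualPairing n).cupProduct
        ((isSES_kummer K n (NeZero.pos n)).δ₀ (baseUnitsInvariant K (b : K) b.ne_zero))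
        (oneCocycleClass _ (scalarCocycle ψ))) = 0)
    (S : Finset (HeightOneSpectrum (𝓞 K)))
    (hS : ∀ v ∉ S,
      haveI : CompactSpace (absoluteGaloisGroup K) := absoluteGaloisGroup_compactSpace K
      localInvariantMap K n v (galoisCohomology.localization (mu K n) (Sum.inr v) 2
        (((mu K n).tateDualPairing n).cupProduct
          ((isSES_kummer K n (NeZero.pos n)).δ₀ (baseUnitsInvariant K (b : K) b.ne_zero))
          (oneCocycleClass _ (scalarCocycle ψ)))) = 0) :
    haveI : CompactSpace (absoluteGaloisGroup K) := absoluteGaloisGroup_compactSpace K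
    ∑ v ∈ S, localInvariantMap K n v (galoisCohomology.localization (mu K n) (Sum.inr v) 2
        (((mu K n).tateDualPairing n).cupProduct
          ((isSES_kummer K n (NeZero.pos n)).δ₀ (baseUnitsInvariant K (b : K) b.ne_zero))
          (oneCocycleClass _ (scalarCocycle ψ)))) = 0 := by
  classical
  haveI : CompactSpace (absoluteGaloisGroup K) := absoluteGaloisGroup_compactSpace K
  -- `n = 1`: nothing to prove
  rcases Nat.lt_or_ge 1 n with hn1 | hn1
  swap
  · have hn : n = 1 := le_antisymm hn1 (NeZero.pos n)
    subst hn
    exact Subsingleton.elim _ _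
  set hR := artinReciprocity_character_holds
  set A := artinIdeleMap L hR with hA
  set c := ((mu K n).tateDualPairing n).cupProduct
    ((isSES_kummer K n (NeZero.pos n)).δ₀ (baseUnitsInvariant K (b : K) b.ne_zero))
    (oneCocycleClass _ (scalarCocycle ψ)) with hc
  -- the character `ψ̄` of `G(L|K)` with `ψ̄ (γ|_L) = ψ γ`
  have hle : (absRestrictNormalHom L).ker ≤ ψ.toMonoidHom.ker := by
    intro γ hγ
    rw [MonoidHom.mem_ker, absRestrictNormalHom_eq_one_iff] at hγ
    have hγ' : γ ∈ ψ.ker := by rw [hker]; exact hγ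
    rw [CyclicCharacter.mem_ker] at hγ'
    rw [MonoidHom.mem_ker]
    change Multiplicative.ofAdd (ψ γ) = 1
    rw [hγ', ofAdd_zero]
  set ψbar : (L ≃ₐ[K] L) →* Multiplicative (ZMod n) :=
    (absRestrictNormalHom L).liftOfSurjective (absRestrictNormalHom_surjective L) ⟨ψ.toMonoidHom, hle⟩
    with hψbar
  have hψbar_apply : ∀ γ : absoluteGaloisGroup K,
      ψbar (absRestrictNormalHom L γ) = Multiplicative.ofAdd (ψ γ) := fun γ =>
    (absRestrictNormalHom L).liftOfRightInverse_comp_apply _ _ _ γ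
  -- the local terms `t_v = ψ̄ (ψ_{L|K} ⟨b⟩_v)`, read additively
  set t : HeightOneSpectrum (𝓞 K) → ZMod n :=
    fun v => Multiplicative.toAdd (ψbar (A (localUnits v (globalToLocalUnits v b)))) with ht
  -- Claim A: `t_v = inv_v (loc_v c)` at every finite place
  have hA_loc : ∀ v : HeightOneSpectrum (𝓞 K),
      t v = localInvariantMap K n v (galoisCohomology.localization (mu K n) (Sum.inr v) 2 c) := by
    intro v
    haveI : CharZero (v.adicCompletion K) := charZero_adicCompletion v
    by_cases hunr : ∀ σ ∈ absInertia (v.adicCompletion K), ψ (absGaloisRestrict K (v.adicCompletion K) σ) = 0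
    · -- unramified: both sides are `-ψ(res w)` for `Art_v w = b`
      obtain ⟨ψE, hIE, hFE, -, -⟩ := exists_normalizedCharacter (v.adicCompletion K) n hn1
      obtain ⟨f, hψf, hf⟩ := exists_apply_absGaloisRestrict_eq_mul (v.adicCompletion K) ψ hunr ψE hIE hFE
      have hinv := localInvariantMap_localization_cupProduct_δ₀ v ψ ψE hIE hFE hψf (b : K) b.ne_zero
      rw [hc, hinv]
      obtain ⟨w, hw⟩ := (isLocalArtinMap_canonicalArtin_holds (v.adicCompletion K)).isOpenQuotientMap_artin.surjective
        (globalToLocalUnits v b)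
      have hord : ord (v.adicCompletion K) (algebraMap K (v.adicCompletion K) (b : K)) = -WeilGroup.deg w := by
        rw [← val_globalToLocalUnits, ← hw, ord_canonicalArtin]
      rw [ht]
      change Multiplicative.toAdd (ψbar (A (localUnits v (globalToLocalUnits v b)))) = _
      rw [← hw, hA, artinIdeleMap_localUnits_canonicalArtin_eq_inv L w, map_inv, hψbar_apply, toAdd_inv,
        toAdd_ofAdd, apply_absGaloisRestrict_toAbsGalois_eq v ψ hunr hf w, hord, Int.cast_neg]
      ring
    · -- ramified: the class vanishes at `v`, `b` is a local norm, `ψ_{L|K}(⟨b⟩_v) = 1`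
      push Not at hunr
      have h0 := hram v hunr
      have hres : resMu K (v.adicCompletion K) n 2 c = 0 := by
        rw [← cohomologyMap_muLocalIso_localization, h0]; exact map_zero _
      have hnorm := mem_range_norm_compositum_of_resMu_cupProduct_δ₀_eq_zero v L ψ hker b hres
      have h1 : A (localUnits v (globalToLocalUnits v b)) = 1 :=
        (artinIdeleMap_localUnits_eq_one_iff_mem_range_norm L _).mpr hnorm
      rw [ht]
      change Multiplicative.toAdd (ψbar (A (localUnits v (globalToLocalUnits v b)))) = _
      rw [h1, map_one, toAdd_one, h0, map_zero]
  -- Claim B: `∑_{v ∈ S'} t_v = 0` for `S' ⊇ S` large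
  obtain ⟨S₀, hS₀⟩ := exists_map_unitIdelesOutside_le K (normClassGroup K L) (isOpen_normClassGroup' L)
  set T := (finite_setOf_valued_ne_one b).toFinset with hT
  set S' := S ∪ S₀ ∪ T with hS'
  have hTS' : ∀ v ∉ S', Valued.v (algebraMap K (v.adicCompletion K) (b : K)) = 1 := by
    intro v hv
    by_contra h
    exact hv (Finset.mem_union_right _ ((finite_setOf_valued_ne_one b).mem_toFinset.mpr h))
  obtain ⟨u, hu, hdec⟩ := principalIdele_mem_mul_unitIdelesOutside b S' hTS'
  have hAu : A u = 1 := by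
    have hu' : u ∈ unitIdelesOutside K S₀ :=
      unitIdelesOutside_antitone (Finset.subset_union_right.trans Finset.subset_union_left) hu
    have hmem : QuotientGroup.mk' (principalIdeles K) u ∈ normClassGroup K L :=
      hS₀ (Subgroup.mem_map_of_mem _ hu')
    rw [← ker_artinClassMap_eq L, MonoidHom.mem_ker, QuotientGroup.mk'_apply, artinClassMap_mk] at hmem
    exact hmem
  -- the composite character `Φ = ψ̄ ∘ ψ_{L|K} : 𝕀_K → ℤ/n` (commutative target)
  set Φ : ideleGroup K →* Multiplicative (ZMod n) := ψbar.comp A with hΦ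
  have hprod : ∏ v ∈ S', Φ (localUnits v (globalToLocalUnits v b)) = 1 := by
    have h : Φ (principalIdele K b) = 1 := by
      rw [hΦ, MonoidHom.comp_apply, hA, artinIdeleMap_eq_one_of_mem_principalIdeles L hR (principalIdele_mem b),
        map_one]
    rw [hdec, map_mul, map_mul, map_prod] at h
    have hΦu : Φ u = 1 := by rw [hΦ, MonoidHom.comp_apply, hAu, map_one]
    have hΦinf : Φ (infiniteIdeles K (globalToInfiniteUnits K b)) = 1 := by
      rw [hΦ, MonoidHom.comp_apply, hinf, map_one]
    rwa [hΦu, mul_one, hΦinf, mul_one] at h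
  have hsum' : ∑ v ∈ S', t v = 0 := by
    rw [ht]
    change ∑ v ∈ S', Multiplicative.toAdd (Φ (localUnits v (globalToLocalUnits v b))) = 0
    rw [← toAdd_prod, hprod, toAdd_one]
  -- assemble: the terms off `S` vanish
  have hSS' : S ⊆ S' := Finset.subset_union_left.trans Finset.subset_union_left
  rw [Finset.sum_subset hSS' (fun v _ hv => hS v hv), ← hsum']
  exact Finset.sum_congr rfl fun v _ => (hA_loc v).symm

/-- **The sum formula for `K` totally complex** (then `ψ_{L|K}` kills every archimedean idèle:
`K_∞ˣ` is connected and norm groups are open, tree `connectedComponent_one_subset_normClassGroup`).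
[cite: CasselsFrohlichANT1967, Ch. VII §10] -/
theorem sum_localInvariantMap_localization_cupProduct_δ₀_eq_zero_of_isTotallyComplex [IsTotallyComplex K]
    (ψ : CyclicCharacter (absoluteGaloisGroup K) n) (hker : ψ.ker = galFixing K L) (b : Kˣ)
    (hram : ∀ v : HeightOneSpectrum (𝓞 K),
      (∃ σ ∈ absInertia (v.adicCompletion K), ψ (absGaloisRestrict K (v.adicCompletion K) σ) ≠ 0) →
      haveI : CompactSpace (absoluteGaloisGroup K) := absoluteGaloisGroup_compactSpace K
      galoisCohomology.localization (mu K n) (Sum.inr v) 2 (((mu K n).tateDualPairing n).cupProduct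
        ((isSES_kummer K n (NeZero.pos n)).δ₀ (baseUnitsInvariant K (b : K) b.ne_zero))
        (oneCocycleClass _ (scalarCocycle ψ))) = 0)
    (S : Finset (HeightOneSpectrum (𝓞 K)))
    (hS : ∀ v ∉ S,
      haveI : CompactSpace (absoluteGaloisGroup K) := absoluteGaloisGroup_compactSpace K
      localInvariantMap K n v (galoisCohomology.localization (mu K n) (Sum.inr v) 2
        (((mu K n).tateDualPairing n).cupProduct
          ((isSES_kummer K n (NeZero.pos n)).δ₀ (baseUnitsInvariant K (b : K) b.ne_zero))
          (oneCocycleClass _ (scalarCocycle ψ)))) = 0) :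
    haveI : CompactSpace (absoluteGaloisGroup K) := absoluteGaloisGroup_compactSpace K
    ∑ v ∈ S, localInvariantMap K n v (galoisCohomology.localization (mu K n) (Sum.inr v) 2
        (((mu K n).tateDualPairing n).cupProduct
          ((isSES_kummer K n (NeZero.pos n)).δ₀ (baseUnitsInvariant K (b : K) b.ne_zero))
          (oneCocycleClass _ (scalarCocycle ψ)))) = 0 := by
  refine sum_localInvariantMap_localization_cupProduct_δ₀_eq_zero L ψ hker b ?_ hram S hS
  -- the archimedean idèle lies in the identity component, hence in the norm group
  haveI := connectedSpace_units_infiniteAdeleRing (K := K)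
  set x := infiniteIdeles K (globalToInfiniteUnits K b) with hx
  have hconn : (QuotientGroup.mk x : ideleGroup K ⧸ principalIdeles K) ∈
      connectedComponent (1 : ideleGroup K ⧸ principalIdeles K) := by
    have hc : Continuous fun y : (InfiniteAdeleRing K)ˣ =>
        (QuotientGroup.mk (infiniteIdeles K y) : ideleGroup K ⧸ principalIdeles K) :=
      (QuotientGroup.continuous_mk (N := principalIdeles K)).comp
        (Continuous.units_map _ (continuous_id.prodMk continuous_const))
    have himage := (isConnected_univ (α := (InfiniteAdeleRing K)ˣ)).image _ hc.continuousOn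
    have hsub := himage.subset_connectedComponent (x := (1 : ideleGroup K ⧸ principalIdeles K))
      ⟨1, Set.mem_univ _, by
        change (QuotientGroup.mk (infiniteIdeles K 1) : ideleGroup K ⧸ principalIdeles K) = 1
        rw [map_one]; rfl⟩
    exact hsub ⟨globalToInfiniteUnits K b, Set.mem_univ _, rfl⟩
  have hmem := connectedComponent_one_subset_normClassGroup L hconn
  rw [← ker_artinClassMap_eq L, SetLike.mem_coe, MonoidHom.mem_ker, artinClassMap_mk] at hmem
  exact hmem

end Sum

end Literature.NumberTheory.GaloisCohomology

end
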